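import Summits.HodgeConjecture.HodgeConjecture.Theorems.Ring2WeilCoverageCMFieldCyclicPrimeRuleSqrtFive
import HarnessLib

/-!
# Ring 2 — Weil-family coverage, CM-field rows: THE COMPLETE RATIONAL PRIME RULE for the cyclic quartic CM fields over
  `F = ℚ(√2)` — `ℚ(√-3(2+√2))` (conductor `48`) and `ℚ(√-(2+√2))` (`⊂ ℚ(ζ₁₆)`, b03.17 re-derived)
  (WEIL-FAMILY-COVERAGE «## b03», cell (xxi‴), part 26)

research route conditional on HC_CM; not a corollary; Q11.4-sentence-2 already refuted in dim ≥ 3.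

On Deligne's carrier `R = S² + pS + q` (`F = ℚ(θ)`, `E = F(√θ)`, rows `W_{2k}.E.δ`, `δ ∈ F^×/Nm_{E/F}(E^×)` labelled by
`T(δ) = {𝔭 : (δ, θ)_𝔭 = -1}`) [cite: Deligne1982HodgeCycles, §4 p. 30, (1), Cor. 4.2]: inert primes by part 21, split
primes by the root character `ε₁₆` (parts 22–23: `2 + √2` is a square mod `v ∣ ℓ` iff `ℓ ≡ ±1 (mod 16)`), the prime
`2 = (√2)²` is a square of `F`, and for conductor `48` the prime `3` (inert in `F`, RAMIFIED in `E`: `θ = -3u`,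
`u = 2 ∓ √2` a unit at `(3)`) is read through the unit `u`: `3u = -θ ∈ Nm(E^×)`, so `[3] = [u]`, and `(u, θ)_{(3)} = -1`
because `u` is a non-square in `𝓞_F/(3) = 𝔽₉` (`u⁴ ≡ -1`) and `ord_{(3)} θ = 1` (O'Meara 63:11a)
[cite: Omeara1963, §63B Cor. 63:11a and Example 63:12].

* §66 **`E = ℚ(√-3(2+√2))`, `R = S² + 12S + 18`: for EVERY prime `ℓ` and even `k`,
  `[ℓ] ≠ [1] ⟺ ℓ ≠ 2 ∧ ℓ mod 48 ∉ {1, 23, 31, 41}`** (`= Gal(ℚ(ζ₄₈)/E)`).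
* §67 **`E = ℚ(√-(2+√2))`, `R = S² + 4S + 2`: `[ℓ] = [1] ⟺ ℓ = 2 ∨ ℓ ≡ 1, 7 (mod 16)`** — b03.17's classification
  (there by degree-one places, the quartic norm form as a sum of squares, a Thue box and peeling) re-derived by the
  uniform local route, for every even `k`.
With parts 24–25 and 16–20: the «primes» column of ALL TWENTY quartic Galois CM-field tables of the census
(`15` biquadratic, `5` cyclic) is one kernel theorem per field, by one method.  No new definition, no named fact, no
sorry; nothing about the Hodge conjecture is asserted (index-set bookkeeping of the census only).
-/

noncomputable section

set_option linter.dupNamespace false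

open Polynomial NumberField IsDedekindDomain

namespace Summit.HodgeConjecture.HodgeConjecture.Ring2.WeilCoverageCM

open Literature.AlgebraicGeometry.Deligne1982
open Literature.AlgebraicGeometry.HodgeTheory (splitDiscriminantClassCM)
open Literature.NumberTheory.QuadraticForms

variable {R : Polynomial ℤ} [Fact (Irreducible (cmPolyQ R))] [Fact (Irreducible (realPolyQ R))]

/-! ### §66 `E = ℚ(√-3(2+√2))` (`R = S² + 12S + 18`, `F = ℚ(√2)`, `θ = -3(2 ± √2)`, conductor `48`):
  `[ℓ] ≠ [1] ⟺ ℓ ≠ 2 ∧ ℓ mod 48 ∉ {1, 23, 31, 41}` -/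

section Cond48

omit [Fact (Irreducible (cmPolyQ R))] in
/-- `√2 = (θ + 6)/3` is an algebraic integer of `F` with square `2`. [folklore] -/
theorem sqrtNegThreeTimesTwoPlusSqrtTwo_ratPrimeRule_exists_sq_eq_two (hR : R = X ^ 2 + C 12 * X + C 18) :
    ∃ s : 𝓞 (realField R), (s : realField R) = (AdjoinRoot.root (realPolyQ R) + 6) / 3 ∧ s ^ 2 = 2 := by
  have hrel := root_rel_quadratic hR
  push_cast at hrel
  have hsq : ((AdjoinRoot.root (realPolyQ R) + 6) / 3) ^ 2 = (2 : realField R) := by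
    linear_combination (1 / 9 : realField R) * hrel
  have hint : IsIntegral ℤ ((AdjoinRoot.root (realPolyQ R) + 6) / 3 : realField R) := by
    refine ⟨X ^ 2 - C 2, by monicity!, ?_⟩
    rw [eval₂_sub, eval₂_X_pow, eval₂_C]
    simp only [eq_intCast, Int.cast_ofNat]
    linear_combination hsq
  refine ⟨⟨_, hint⟩, rfl, ?_⟩
  refine RingOfIntegers.ext ?_
  simp only [map_pow, map_ofNat]
  exact hsq

omit [Fact (Irreducible (cmPolyQ R))] in
/-- **The unit `u = -θ/3 = 2 ± √2 ∈ 𝓞_F`**: `u² = 4u - 2` (so `N(u) = 2`, `θ = -3u`). [folklore] -/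
theorem sqrtNegThreeTimesTwoPlusSqrtTwo_ratPrimeRule_exists_unit (hR : R = X ^ 2 + C 12 * X + C 18) :
    ∃ u : 𝓞 (realField R), (u : realField R) = -AdjoinRoot.root (realPolyQ R) / 3 ∧ u ^ 2 = 4 * u - 2 := by
  have hrel := root_rel_quadratic hR
  push_cast at hrel
  have hsq : (-AdjoinRoot.root (realPolyQ R) / 3) ^ 2 = 4 * (-AdjoinRoot.root (realPolyQ R) / 3) - (2 : realField R) := by
    linear_combination (1 / 9 : realField R) * hrel
  have hint : IsIntegral ℤ (-AdjoinRoot.root (realPolyQ R) / 3 : realField R) := by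
    refine ⟨X ^ 2 - C 4 * X + C 2, by monicity!, ?_⟩
    rw [eval₂_add, eval₂_sub, eval₂_X_pow, eval₂_mul, eval₂_C, eval₂_X, eval₂_C, eq_intCast, eq_intCast]
    push_cast
    linear_combination hsq
  refine ⟨⟨_, hint⟩, rfl, ?_⟩
  refine RingOfIntegers.ext ?_
  simp only [map_pow, map_sub, map_mul, map_ofNat]
  exact hsq

omit [Fact (Irreducible (cmPolyQ R))] in
/-- **`F = ℚ(√2)` has exactly one dyadic place** `(√2)` (in this carrier's terms). [folklore] -/
theorem sqrtNegThreeTimesTwoPlusSqrtTwo_ratPrimeRule_dyadic_unique (hR : R = X ^ 2 + C 12 * X + C 18)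
    (v v' : HeightOneSpectrum (𝓞 (realField R))) (h2 : (2 : 𝓞 (realField R)) ∈ v.asIdeal)
    (h2' : (2 : 𝓞 (realField R)) ∈ v'.asIdeal) : v = v' := by
  obtain ⟨s, -, hs⟩ := sqrtNegThreeTimesTwoPlusSqrtTwo_ratPrimeRule_exists_sq_eq_two hR
  exact place_unique_of_sq_eq_mul (finrank_realField_quadratic hR) Nat.prime_two (π := s) (w := 1) (a := 0)
    (b := 1) (by rw [hs]; norm_num) (by norm_num) v v' (by exact_mod_cast h2) (by exact_mod_cast h2')

omit [Fact (Irreducible (cmPolyQ R))] in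
/-- **The odd places of `θ` are harmless for every prime `ℓ ≠ 3`** (`θ ∈ v ∌ 2 ⟹ 18 ∈ v ⟹ 3 ∈ v`, inert in `F`:
`𝓞_F/v = 𝔽₉`, every integer a square). [folklore] -/
theorem sqrtNegThreeTimesTwoPlusSqrtTwo_ratPrimeRule_root_places (hR : R = X ^ 2 + C 12 * X + C 18)
    {θₒ : 𝓞 (realField R)} (hθ : (θₒ : realField R) = AdjoinRoot.root (realPolyQ R)) {ℓ : ℕ} (hℓ : ℓ.Prime)
    (hℓ3 : ℓ ≠ 3) :
    ∀ v : HeightOneSpectrum (𝓞 (realField R)), (2 : 𝓞 (realField R)) ∉ v.asIdeal → θₒ ∈ v.asIdeal →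
      (ℓ : 𝓞 (realField R)) ∉ v.asIdeal ∧
        (IsSquare (Ideal.Quotient.mk v.asIdeal (ℓ : 𝓞 (realField R))) ∨
          ¬ Odd (WithZero.log (v.valuation (realField R) ((θₒ : 𝓞 (realField R)) : realField R)))) := by
  have hnsq : ¬ IsSquare (((2 : ℤ) : ℤ) : ZMod 3) := by decide
  have hK := finrank_realField_quadratic hR
  obtain ⟨s, -, hs⟩ := sqrtNegThreeTimesTwoPlusSqrtTwo_ratPrimeRule_exists_sq_eq_two hR
  have hs' : s ^ 2 = ((2 : ℤ) : 𝓞 (realField R)) := by rw [hs]; norm_num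
  intro v h2 hθv
  have h18 : ((18 : ℤ) : 𝓞 (realField R)) ∈ v.asIdeal := intCast_mem_of_root_mem hR hθ v hθv
  have e : ((18 : ℤ) : 𝓞 (realField R)) = 2 * (3 * 3) := by push_cast; norm_num
  rw [e] at h18
  have h3v : (3 : 𝓞 (realField R)) ∈ v.asIdeal := by
    rcases v.isPrime.mem_or_mem h18 with h | h
    · exact absurd h h2
    · rcases v.isPrime.mem_or_mem h with h | h <;> exact h
  obtain ⟨hℓv, hsqv⟩ := natCast_notMem_and_isSquare_of_inert_radicand hK hs' Nat.prime_three hnsq hℓ hℓ3 v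
    (by exact_mod_cast h3v)
  exact ⟨hℓv, Or.inl hsqv⟩

/-- **`[2] = [1]`** for `ℚ(√-3(2+√2))`: `2 = ((θ + 6)/3)²` is a square in `F`. [cite: Deligne1982HodgeCycles, §4 Cor. 4.2] -/
theorem sqrtNegThreeTimesTwoPlusSqrtTwo_ratPrimeRule_mk_two_eq_splitDiscriminantClassCM
    (hR : R = X ^ 2 + C 12 * X + C 18) (qℓ : (realField R)ˣ) (hq : (qℓ : realField R) = 2) {k : ℕ} (hk : Even k) :
    (QuotientGroup.mk qℓ : cmNormResidueGroup R) = splitDiscriminantClassCM R k := by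
  have hrel := root_rel_quadratic hR
  push_cast at hrel
  exact mk_eq_splitDiscriminantClassCM_of_eq_sq qℓ (x := (AdjoinRoot.root (realPolyQ R) + 6) / 3)
    (by rw [hq]; linear_combination (-1 / 9 : realField R) * hrel) hk

/-- **`[3] ≠ [1]`** for `ℚ(√-3(2+√2))` (any even `k`): with the unit `u = -θ/3` one has `3u = -θ = Nm_{E/F}(√θ)`, so
`[3] = [u]⁻¹`; and `(u, θ)_v = -1` at the place `v = (3)` (inert in `F`, `N v = 9`): `u` is a `v`-unit NON-square mod
`v` (`u⁴ + 1 = 48u - 27 ≡ 0`, Euler) and `ord_v θ = ord_v 3 = 1` is odd (O'Meara 63:11a).  Hence `[u] ≠ [1]` and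
`[3] ≠ [1]`: the prime `3`, inert in `F` and ramified in `E`, is a non-norm. [cite: Deligne1982HodgeCycles, §4 (1)
and Cor. 4.2] [cite: Omeara1963, §63B Cor. 63:11a] -/
theorem sqrtNegThreeTimesTwoPlusSqrtTwo_ratPrimeRule_mk_three_ne_splitDiscriminantClassCM
    (hR : R = X ^ 2 + C 12 * X + C 18) (qℓ : (realField R)ˣ) (hq : (qℓ : realField R) = 3) {k : ℕ} (hk : Even k) :
    (QuotientGroup.mk qℓ : cmNormResidueGroup R) ≠ splitDiscriminantClassCM R k := by
  have hK := finrank_realField_quadratic hR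
  have hnsq : ¬ IsSquare (((2 : ℤ) : ℤ) : ZMod 3) := by decide
  obtain ⟨hRm, -⟩ := monic_and_natDegree_of_quadratic R hR
  obtain ⟨θₒ, hθ⟩ := exists_ringOfIntegers_coe_eq_root hRm
  obtain ⟨s, -, hs⟩ := sqrtNegThreeTimesTwoPlusSqrtTwo_ratPrimeRule_exists_sq_eq_two hR
  have hs' : s ^ 2 = ((2 : ℤ) : 𝓞 (realField R)) := by rw [hs]; norm_num
  obtain ⟨u, hu, hu2⟩ := sqrtNegThreeTimesTwoPlusSqrtTwo_ratPrimeRule_exists_unit hR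
  -- the place `v = (3)`: `N v = 9`, `2 ∉ v`, `u ∉ v`
  obtain ⟨v, h3v⟩ := exists_place_natCast_mem hK Nat.prime_three
  have hN : Ideal.absNorm v.asIdeal = 3 ^ 2 := absNorm_eq_sq_of_inert_radicand hK hs' Nat.prime_three hnsq v h3v
  have h3v' : ((3 : ℤ) : 𝓞 (realField R)) ∈ v.asIdeal := by exact_mod_cast h3v
  have h2v : (2 : 𝓞 (realField R)) ∉ v.asIdeal := by
    have := intCast_notMem_of_isCoprime v (show IsCoprime (3 : ℤ) 2 by norm_num) h3v'
    exact_mod_cast this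
  have huv : u ∉ v.asIdeal := fun h ↦ h2v (by
    have e : (2 : 𝓞 (realField R)) = u * (4 - u) := by linear_combination hu2
    rw [e]; exact v.asIdeal.mul_mem_right _ h)
  -- `u` is a non-square mod `v`: `u⁴ + 1 = 3·(16u - 9) ∈ v`, `N v = 2·4 + 1`
  have hns : ¬ IsSquare (Ideal.Quotient.mk v.asIdeal u) := by
    refine not_isSquare_residue_of_pow_add_one_mem v h2v (n := 4) (by rw [hN]; norm_num) ?_
    have e : u ^ 4 + 1 = ((3 : ℕ) : 𝓞 (realField R)) * (16 * u - 9) := by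
      push_cast; linear_combination (u ^ 2 + 4 * u + 14) * hu2
    rw [e]; exact v.asIdeal.mul_mem_right _ h3v
  -- `ord_v θ = 1`: `v = (3)`, `θ = -3u`
  have hv3 : v.asIdeal = Ideal.span {((3 : ℕ) : 𝓞 (realField R))} :=
    (ideal_eq_of_le_of_absNorm_eq ((Ideal.span_singleton_le_iff_mem _).2 h3v) (by rw [hN]; norm_num)
      (by rw [absNorm_span_natCast, hK, hN])).symm
  have hord3 : WithZero.log (v.valuation (realField R) ((3 : ℕ) : realField R)) = -1 := by
    rw [show ((3 : ℕ) : realField R) = algebraMap (𝓞 (realField R)) (realField R) ((3 : ℕ) : 𝓞 (realField R)) by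
      rw [map_natCast], HeightOneSpectrum.valuation_of_algebraMap,
      HeightOneSpectrum.intValuation_singleton (v := v) (by norm_num) hv3, WithZero.log_exp]
  have hune : ((u : 𝓞 (realField R)) : realField R) ≠ 0 := fun h ↦ huv (by
    rw [show u = 0 from RingOfIntegers.coe_injective (by simpa using h)]; exact v.asIdeal.zero_mem)
  have h3ne : ((3 : ℕ) : realField R) ≠ 0 := by norm_num
  have hodd : Odd (WithZero.log (v.valuation (realField R) ((θₒ : 𝓞 (realField R)) : realField R))) := by
    have e : ((θₒ : 𝓞 (realField R)) : realField R) = -(((3 : ℕ) : realField R) * ((u : 𝓞 (realField R)) : realField R)) := by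
      rw [hθ, hu]; push_cast; ring
    rw [e, Valuation.map_neg, Valuation.map_mul,
      WithZero.log_mul ((Valuation.ne_zero_iff _).2 h3ne) ((Valuation.ne_zero_iff _).2 hune), hord3,
      log_valuation_coe_eq_zero_of_notMem v huv]
    decide
  -- `[u] ≠ [1]` (O'Meara 63:11a at `v`), `[3·u] = [-θ] = [1]`
  have hfac : AdjoinRoot.root (realPolyQ R) = (1 : realField R) ^ 2 * ((θₒ : 𝓞 (realField R)) : realField R) := by
    rw [one_pow, one_mul, hθ]
  set qu : (realField R)ˣ := Units.mk0 _ hune with hqu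
  have hune' := mk_coe_ne_splitDiscriminantClassCM_of_notMem hfac v h2v huv hns hodd qu (Units.val_mk0 _) hk
  have hprod : (QuotientGroup.mk (qℓ * qu) : cmNormResidueGroup R) = splitDiscriminantClassCM R k :=
    mk_eq_splitDiscriminantClassCM_of_eq_sq_sub_mul_sq hfac (qℓ * qu) (x := 0) (y := 1)
      (by rw [Units.val_mul, hqu, Units.val_mk0, hq, hu, hθ]; ring) hk
  intro h3
  apply hune'
  have h1 : splitDiscriminantClassCM R k = 1 := by rw [splitDiscriminantClassCM, hk.neg_one_pow, QuotientGroup.mk_one]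
  rw [QuotientGroup.mk_mul] at hprod
  rw [h1]
  calc (QuotientGroup.mk qu : cmNormResidueGroup R)
      = (QuotientGroup.mk qℓ : cmNormResidueGroup R)⁻¹ *
          ((QuotientGroup.mk qℓ : cmNormResidueGroup R) * (QuotientGroup.mk qu : cmNormResidueGroup R)) :=
        (inv_mul_cancel_left _ _).symm
    _ = 1 := by rw [hprod, h3, inv_mul_cancel]

/-- **THE RATIONAL PRIME RULE for `ℚ(√-3(2+√2))`** (conductor `48`): for EVERY rational prime `ℓ` and even `k`, the row
`W_{2k}.E.[ℓ]` is non-split iff **`ℓ ≠ 2` and `ℓ mod 48 ∉ {1, 23, 31, 41}`** (`H = Gal(ℚ(ζ₄₈)/E) = {1, 23, 31, 41}`):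
`[2] = [(√2)²·…] = [1]`; `[3] ≠ [1]` (ramified); inert `ℓ ≡ ±3 (mod 8)` non-norms (part 21); split `ℓ ≡ ±1 (mod 8)`
decided by `(-3|ℓ)·ε₁₆(ℓ)` (parts 22–23). [cite: Deligne1982HodgeCycles, §4 (1) and Cor. 4.2]
[cite: Omeara1963, §63B Example 63:12 and §71D Thm. 71:18] -/
theorem sqrtNegThreeTimesTwoPlusSqrtTwo_mk_prime_ne_splitDiscriminantClassCM_iff_mod (hR : R = X ^ 2 + C 12 * X + C 18)
    {ℓ : ℕ} (hℓ : ℓ.Prime) (qℓ : (realField R)ˣ) (hq : (qℓ : realField R) = ℓ) {k : ℕ} (hk : Even k) :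
    (QuotientGroup.mk qℓ : cmNormResidueGroup R) ≠ splitDiscriminantClassCM R k ↔
      ℓ ≠ 2 ∧ ¬ (ℓ % 48 = 1 ∨ ℓ % 48 = 23 ∨ ℓ % 48 = 31 ∨ ℓ % 48 = 41) := by
  by_cases h2 : ℓ = 2
  · subst h2
    exact iff_of_false (not_not.2 (sqrtNegThreeTimesTwoPlusSqrtTwo_ratPrimeRule_mk_two_eq_splitDiscriminantClassCM hR qℓ
      (by rw [hq]; norm_num) hk)) (fun h ↦ h.1 rfl)
  by_cases h3 : ℓ = 3
  · subst h3
    exact iff_of_true (sqrtNegThreeTimesTwoPlusSqrtTwo_ratPrimeRule_mk_three_ne_splitDiscriminantClassCM hR qℓ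
      (by rw [hq]; norm_num) hk) ⟨by omega, by omega⟩
  by_cases hin : ℓ % 8 = 3 ∨ ℓ % 8 = 5
  · exact iff_of_true (sqrtNegThreeTimesTwoPlusSqrtTwo_ratPrimeRule_mk_prime_ne_splitDiscriminantClassCM_of_inert hR hℓ h3 hin
      qℓ hq k) ⟨h2, by omega⟩
  have hodd : ℓ % 2 = 1 := (Nat.Prime.mod_two_eq_one_iff_ne_two hℓ).2 h2
  have hsp : ℓ % 8 = 1 ∨ ℓ % 8 = 7 := by omega
  haveI := Fact.mk hℓ
  obtain ⟨hRm, -⟩ := monic_and_natDegree_of_quadratic R hR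
  obtain ⟨θₒ, hθ⟩ := exists_ringOfIntegers_coe_eq_root hRm
  have hroots := roots_real_neg_of_quadratic hR (by norm_num) (by norm_num) (by norm_num)
  have hdisc : ¬ (ℓ : ℤ) ∣ (12 : ℤ) ^ 2 - 4 * 18 := fun h ↦ by
    have h' : ℓ ∣ 2 ^ 3 * 3 ^ 2 * 5 ^ 0 := by norm_num at h ⊢; exact_mod_cast h
    rcases eq_of_prime_dvd_two_pow_mul hℓ h' with rfl | rfl | rfl <;> omega
  have hℓq : ¬ (ℓ : ℤ) ∣ (18 : ℤ) := fun h ↦ by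
    have h' : ℓ ∣ 2 ^ 1 * 3 ^ 2 * 5 ^ 0 := by norm_num; exact_mod_cast h
    rcases eq_of_prime_dvd_two_pow_mul hℓ h' with rfl | rfl | rfl <;> omega
  have h60 : (6 : ZMod ℓ) ≠ 0 := by
    have h20 : (2 : ZMod ℓ) ≠ 0 := by exact_mod_cast natCast_prime_ne_zero_zmod Nat.prime_two h2
    have h30 : (3 : ZMod ℓ) ≠ 0 := by exact_mod_cast natCast_prime_ne_zero_zmod Nat.prime_three h3
    rw [show (6 : ZMod ℓ) = 2 * 3 by norm_num]; exact mul_ne_zero h20 h30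
  have hdsq : IsSquare (((12 : ℤ) ^ 2 - 4 * 18 : ℤ) : ZMod ℓ) := by
    push_cast
    rw [show (72 : ZMod ℓ) = 2 * 6 ^ 2 by norm_num, isSquare_mul_sq_iff_of_ne_zero h60, ZMod.exists_sq_eq_two_iff h2]
    exact hsp
  rw [mk_natCast_ne_splitDiscriminantClassCM_iff_of_root_character hR hroots hθ
    (sqrtNegThreeTimesTwoPlusSqrtTwo_ratPrimeRule_dyadic_unique hR) hℓ h2 hℓq hdisc hdsq
    (sqrtNegThreeTimesTwoPlusSqrtTwo_ratPrimeRule_root_places hR hθ hℓ h3)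
    (fun r hr ↦ isSquare_root_iff_cond48 h2 h3 r (by push_cast at hr; exact hr)) qℓ hq hk]
  have h3' : ℓ % 3 ≠ 0 := fun h ↦ h3 ((Nat.prime_dvd_prime_iff_eq Nat.prime_three hℓ).1 (Nat.dvd_of_mod_eq_zero h)).symm
  have key : ∀ n : ℕ, n % 3 ≠ 0 → (n % 8 = 1 ∨ n % 8 = 7) →
      (¬ (n % 3 = 1 ↔ (n % 16 = 1 ∨ n % 16 = 15)) ↔ (n ≠ 2 ∧ ¬ (n % 48 = 1 ∨ n % 48 = 23 ∨ n % 48 = 31 ∨ n % 48 = 41))) := by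
    intro n hn3 hn8
    obtain ⟨k', r, hr, rfl⟩ : ∃ k' r, r < 48 ∧ n = 48 * k' + r :=
      ⟨n / 48, n % 48, Nat.mod_lt _ (by norm_num), (Nat.div_add_mod n 48).symm⟩
    interval_cases r <;> omega
  exact key ℓ h3' hsp

/-- Equivalently: **`[ℓ] = [1] ⟺ ℓ = 2 ∨ ℓ mod 48 ∈ {1, 23, 31, 41}`** (`ℚ(√-3(2+√2))`, every prime `ℓ`, even `k`).
[cite: Deligne1982HodgeCycles, §4 (1) and Cor. 4.2] -/
theorem sqrtNegThreeTimesTwoPlusSqrtTwo_mk_prime_eq_splitDiscriminantClassCM_iff_mod (hR : R = X ^ 2 + C 12 * X + C 18)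
    {ℓ : ℕ} (hℓ : ℓ.Prime) (qℓ : (realField R)ˣ) (hq : (qℓ : realField R) = ℓ) {k : ℕ} (hk : Even k) :
    (QuotientGroup.mk qℓ : cmNormResidueGroup R) = splitDiscriminantClassCM R k ↔
      ℓ = 2 ∨ (ℓ % 48 = 1 ∨ ℓ % 48 = 23 ∨ ℓ % 48 = 31 ∨ ℓ % 48 = 41) := by
  have h := sqrtNegThreeTimesTwoPlusSqrtTwo_mk_prime_ne_splitDiscriminantClassCM_iff_mod hR hℓ qℓ hq hk
  tauto

end Cond48

/-! ### §67 `E = ℚ(√-(2+√2))` (`R = S² + 4S + 2`, `F = ℚ(√2)`, `θ = -(2 ± √2)`, inside `ℚ(ζ₁₆)`):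
  `[ℓ] = [1] ⟺ ℓ = 2 ∨ ℓ ≡ 1, 7 (mod 16)` — b03.17 re-derived by the uniform route -/

section Cond16

omit [Fact (Irreducible (cmPolyQ R))] in
/-- `√2 = -(θ + 2)` is an algebraic integer of `F` with square `2`. [folklore] -/
theorem sqrtNegTwoPlusSqrtTwo_ratPrimeRule_exists_sq_eq_two (hR : R = X ^ 2 + C 4 * X + C 2) :
    ∃ s : 𝓞 (realField R), (s : realField R) = -(AdjoinRoot.root (realPolyQ R) + 2) ∧ s ^ 2 = 2 := by
  have hrel := root_rel_quadratic hR
  push_cast at hrel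
  have hsq : (-(AdjoinRoot.root (realPolyQ R) + 2)) ^ 2 = (2 : realField R) := by linear_combination hrel
  have hint : IsIntegral ℤ (-(AdjoinRoot.root (realPolyQ R) + 2) : realField R) := by
    refine ⟨X ^ 2 - C 2, by monicity!, ?_⟩
    rw [eval₂_sub, eval₂_X_pow, eval₂_C]
    simp only [eq_intCast, Int.cast_ofNat]
    linear_combination hsq
  refine ⟨⟨_, hint⟩, rfl, ?_⟩
  refine RingOfIntegers.ext ?_
  simp only [map_pow, map_ofNat]
  exact hsq

omit [Fact (Irreducible (cmPolyQ R))] in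
/-- **`F = ℚ(√2)` has exactly one dyadic place** (in this carrier's terms). [folklore] -/
theorem sqrtNegTwoPlusSqrtTwo_ratPrimeRule_dyadic_unique (hR : R = X ^ 2 + C 4 * X + C 2)
    (v v' : HeightOneSpectrum (𝓞 (realField R))) (h2 : (2 : 𝓞 (realField R)) ∈ v.asIdeal)
    (h2' : (2 : 𝓞 (realField R)) ∈ v'.asIdeal) : v = v' := by
  obtain ⟨s, -, hs⟩ := sqrtNegTwoPlusSqrtTwo_ratPrimeRule_exists_sq_eq_two hR
  exact place_unique_of_sq_eq_mul (finrank_realField_quadratic hR) Nat.prime_two (π := s) (w := 1) (a := 0)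
    (b := 1) (by rw [hs]; norm_num) (by norm_num) v v' (by exact_mod_cast h2) (by exact_mod_cast h2')

omit [Fact (Irreducible (cmPolyQ R))] in
/-- **`θ = -(2 ± √2)` has no odd place** (`θ ∈ v ⟹ 2 ∈ v`): hypothesis `hb` of part 22 is vacuous. [folklore] -/
theorem sqrtNegTwoPlusSqrtTwo_ratPrimeRule_root_places (hR : R = X ^ 2 + C 4 * X + C 2)
    {θₒ : 𝓞 (realField R)} (hθ : (θₒ : realField R) = AdjoinRoot.root (realPolyQ R)) (ℓ : ℕ) :
    ∀ v : HeightOneSpectrum (𝓞 (realField R)), (2 : 𝓞 (realField R)) ∉ v.asIdeal → θₒ ∈ v.asIdeal →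
      (ℓ : 𝓞 (realField R)) ∉ v.asIdeal ∧
        (IsSquare (Ideal.Quotient.mk v.asIdeal (ℓ : 𝓞 (realField R))) ∨
          ¬ Odd (WithZero.log (v.valuation (realField R) ((θₒ : 𝓞 (realField R)) : realField R)))) := by
  intro v h2 hθv
  have h2v : ((2 : ℤ) : 𝓞 (realField R)) ∈ v.asIdeal := intCast_mem_of_root_mem hR hθ v hθv
  push_cast at h2v
  exact absurd h2v h2

/-- **`[2] = [1]`** for `ℚ(√-(2+√2))` (any even `k`): `2 = (θ + 2)²`. [cite: Deligne1982HodgeCycles, §4 Cor. 4.2] -/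
theorem sqrtNegTwoPlusSqrtTwo_ratPrimeRule_mk_two_eq_splitDiscriminantClassCM (hR : R = X ^ 2 + C 4 * X + C 2)
    (qℓ : (realField R)ˣ) (hq : (qℓ : realField R) = 2) {k : ℕ} (hk : Even k) :
    (QuotientGroup.mk qℓ : cmNormResidueGroup R) = splitDiscriminantClassCM R k := by
  have hrel := root_rel_quadratic hR
  push_cast at hrel
  exact mk_eq_splitDiscriminantClassCM_of_eq_sq qℓ (x := AdjoinRoot.root (realPolyQ R) + 2)
    (by rw [hq]; linear_combination -hrel) hk

/-- **THE RATIONAL PRIME RULE for `ℚ(√-(2+√2))` by the uniform route** (any even `k`): for EVERY rational prime `ℓ`,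
**`[ℓ] = [(-1)^k] ⟺ ℓ = 2 ∨ ℓ ≡ 1, 7 (mod 16)`** (`H = Gal(ℚ(ζ₁₆)/E) = {1, 7}`) — b03.17's classification re-derived
from the local symbols: inert `ℓ ≡ ±3 (mod 8)` (part 21), split `ℓ ≡ ±1 (mod 8)` by `(-1|ℓ)·ε₁₆(ℓ)` (parts 22–23),
`[2] = [(θ+2)²]`. [cite: Deligne1982HodgeCycles, §4 (1) and Cor. 4.2] [cite: Omeara1963, §63B Example 63:12 and
§71D Thm. 71:18] -/
theorem sqrtNegTwoPlusSqrtTwo_ratPrimeRule_mk_prime_eq_splitDiscriminantClassCM_iff_mod (hR : R = X ^ 2 + C 4 * X + C 2)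
    {ℓ : ℕ} (hℓ : ℓ.Prime) (qℓ : (realField R)ˣ) (hq : (qℓ : realField R) = ℓ) {k : ℕ} (hk : Even k) :
    (QuotientGroup.mk qℓ : cmNormResidueGroup R) = splitDiscriminantClassCM R k ↔
      ℓ = 2 ∨ ℓ % 16 = 1 ∨ ℓ % 16 = 7 := by
  by_cases h2 : ℓ = 2
  · subst h2
    exact iff_of_true (sqrtNegTwoPlusSqrtTwo_ratPrimeRule_mk_two_eq_splitDiscriminantClassCM hR qℓ (by rw [hq]; norm_num) hk)
      (Or.inl rfl)
  by_cases hin : ℓ % 8 = 3 ∨ ℓ % 8 = 5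
  · exact iff_of_false (sqrtNegTwoPlusSqrtTwo_ratPrimeRule_mk_prime_ne_splitDiscriminantClassCM_of_inert hR hℓ hin qℓ hq k)
      (by omega)
  have hodd : ℓ % 2 = 1 := (Nat.Prime.mod_two_eq_one_iff_ne_two hℓ).2 h2
  have hsp : ℓ % 8 = 1 ∨ ℓ % 8 = 7 := by omega
  haveI := Fact.mk hℓ
  obtain ⟨hRm, -⟩ := monic_and_natDegree_of_quadratic R hR
  obtain ⟨θₒ, hθ⟩ := exists_ringOfIntegers_coe_eq_root hRm
  have hroots := roots_real_neg_of_quadratic hR (by norm_num) (by norm_num) (by norm_num)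
  have hdisc : ¬ (ℓ : ℤ) ∣ (4 : ℤ) ^ 2 - 4 * 2 := fun h ↦ by
    have h' : ℓ ∣ 2 ^ 3 * 3 ^ 0 * 5 ^ 0 := by norm_num at h ⊢; exact_mod_cast h
    rcases eq_of_prime_dvd_two_pow_mul hℓ h' with rfl | rfl | rfl <;> omega
  have hℓq : ¬ (ℓ : ℤ) ∣ (2 : ℤ) := fun h ↦ by
    have h' : ℓ ∣ 2 ^ 1 * 3 ^ 0 * 5 ^ 0 := by norm_num; exact_mod_cast h
    rcases eq_of_prime_dvd_two_pow_mul hℓ h' with rfl | rfl | rfl <;> omega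
  have h20 : (2 : ZMod ℓ) ≠ 0 := by exact_mod_cast natCast_prime_ne_zero_zmod Nat.prime_two h2
  have hdsq : IsSquare (((4 : ℤ) ^ 2 - 4 * 2 : ℤ) : ZMod ℓ) := by
    push_cast
    rw [show (8 : ZMod ℓ) = 2 * 2 ^ 2 by norm_num, isSquare_mul_sq_iff_of_ne_zero h20, ZMod.exists_sq_eq_two_iff h2]
    exact hsp
  have h := mk_natCast_ne_splitDiscriminantClassCM_iff_of_root_character hR hroots hθ
    (sqrtNegTwoPlusSqrtTwo_ratPrimeRule_dyadic_unique hR) hℓ h2 hℓq hdisc hdsq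
    (sqrtNegTwoPlusSqrtTwo_ratPrimeRule_root_places hR hθ ℓ)
    (fun r hr ↦ isSquare_root_iff_cond16 h2 r (by push_cast at hr; exact hr)) qℓ hq hk
  rw [(not_iff_not.1 h : (QuotientGroup.mk qℓ : cmNormResidueGroup R) = splitDiscriminantClassCM R k ↔
    (ℓ % 4 = 1 ↔ (ℓ % 16 = 1 ∨ ℓ % 16 = 15)))]
  have key : ∀ n : ℕ, (n % 8 = 1 ∨ n % 8 = 7) →
      ((n % 4 = 1 ↔ (n % 16 = 1 ∨ n % 16 = 15)) ↔ (n = 2 ∨ n % 16 = 1 ∨ n % 16 = 7)) := by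
    intro n hn8
    obtain ⟨k', r, hr, rfl⟩ : ∃ k' r, r < 16 ∧ n = 16 * k' + r :=
      ⟨n / 16, n % 16, Nat.mod_lt _ (by norm_num), (Nat.div_add_mod n 16).symm⟩
    interval_cases r <;> omega
  exact key ℓ hsp

end Cond16

end Summit.HodgeConjecture.HodgeConjecture.Ring2.WeilCoverageCM

end
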